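import Summits.Ventures.PackingBounds.Configurations.CliqueFrame
import Summits.Ventures.PackingBounds.Configurations.DesignIdentities
import Summits.Ventures.PackingBounds.Configurations.Dim6Card27EnergyRigidity

/-!
# Uniqueness of the 27-point sharp configuration on `S⁵` (the `(6, 27, 1/4)` code, `E₆` / Schläfli)

Framing: lottery ticket; floor = certified bounds/negative ranges. Venture `PackingBounds` (cell
`pub-packcert`, seat `pub-packcert-energy`) — Cohn–Kumar Table 1, row `(6, 27)`, uniqueness column.

**Theorem** (`isometric`). Any two `27`-point codes in `ℝ⁶` with pairwise inner products `≤ 1/4` are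
isometric; with `Dim6Card27EnergyRigidity`, every `27`-point ground state of `(1+t)^k` (`k ≥ 4`) is isometric
to every such code (`isometric_of_ckPow_energy_eq`). In print this follows from the uniqueness of the Schläfli
strongly regular graph (Cohn–Kumar, Appendix A; Godsil–Royle Lemma 10.9.4); the proof here is the
classification-free "clique frame" argument of `Dim5Card16Unique`:

1. complementary slackness for `(t + 1/2)²(t - 1/4)`: inner products in `{1/4, -1/2}`, moments of orders
   `1, 2, 3` vanish (`inner_of_card_eq_27`, `moments_of_card_eq_27`), hence the strength-1 and strength-2
   identities `Σ_w ⟪u,w⟫ = 0`, `Σ_w ⟪u,w⟫⟪v,w⟫ = (9/2)⟪u,v⟫` (`DesignIdentities`);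
2. for `x ∈ C` and `y ∈ C` at `1/4` from `x`, the set `K` of points at `1/4` from `x` and `-1/2` from `y` has five
   elements (functional `(16/9)(⟪x,w⟫ + 1/2)(1/4 - ⟪y,w⟫)`) pairwise at `1/4` (three points pairwise at `-1/2`
   sum to zero, impossible against `x`): `{x} ∪ K` is a `1/4`-frame, a basis of `ℝ⁶`;
3. the profile of every `z ∈ C` against the frame has `#{j : ⟪z,aⱼ⟫ = -1/2} ∈ {2, 5}` (norm identity), which
   exhibits `C` as the image of a fixed `27`-member family (`exists_index`, `eq_image`);
4. `CliqueFrame.isometric_of_frames`.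

## References
* H. Cohn, A. Kumar, J. Amer. Math. Soc. 20 (2007) 99–148, Table 1 and Appendix A. [`CohnKumar2006`]
-/

noncomputable section

namespace Summit.Ventures.PackingBounds.Config.Dim6Card27Unique

open Finset Module Literature.Analysis.SpecialFunctions Literature.Geometry.DiscreteGeometry CliqueFrame

/-! ### Complementary slackness -/

/-- The sharp certificate `(t + 1/2)²(t - 1/4)` in the Gegenbauer basis of `S⁵` (`μ = 2`). -/
private theorem hpoly (t : ℝ) : ∑ k ∈ range (3 + 1),
    (fun k => match k with | 0 => 1 / 16 | 1 => 3 / 32 | 2 => 1 / 16 | 3 => 1 / 32 | _ => 0) k *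
      gegenbauerSum (2 : ℝ) k t = (t + 1 / 2) ^ 2 * (t - 1 / 4) := by
  simp [Finset.sum_range_succ, gegenbauerSum, gegenbauerCoeff, Finset.prod_range_succ, Nat.factorial]
  ring

section config

variable {C : Finset (EuclideanSpace ℝ (Fin 6))} (h1 : ∀ x ∈ C, ‖x‖ = 1)
  (h2 : ∀ x ∈ C, ∀ y ∈ C, x ≠ y → inner ℝ x y ≤ 1 / 4) (hN : C.card = 27)
include h1 h2 hN

/-- **Inner products of a `(6, 27, 1/4)` code** lie in `{1/4, -1/2}`. [cite: CohnKumar2006, Appendix A] -/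
theorem inner_of_card_eq_27 {x y : EuclideanSpace ℝ (Fin 6)} (hx : x ∈ C) (hy : y ∈ C) (hxy : x ≠ y) :
    inner ℝ x y = 1 / 4 ∨ inner ℝ x y = -1 / 2 := by
  have h0 := DelsarteLP.sum_eq_zero_of_card_mul_eq (n := 6) (μ := 2) (by norm_num) (by norm_num) 3
    (fun k => match k with | 0 => 1 / 16 | 1 => 3 / 32 | 2 => 1 / 16 | 3 => 1 / 32 | _ => 0)
    ?_ (1 / 4) ?_ C h1 h2 ?_ hx hy hxy
  · rw [hpoly] at h0
    rcases mul_eq_zero.mp h0 with h | h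
    · right
      have := pow_eq_zero_iff two_ne_zero |>.mp h
      linarith
    · left; linarith
  · intro k; split <;> norm_num
  · intro t ht1 ht2
    rw [hpoly]
    exact mul_nonpos_of_nonneg_of_nonpos (by positivity) (by linarith)
  · rw [hN]
    norm_num [Finset.sum_range_succ, gegenbauerSum, gegenbauerCoeff, Finset.prod_range_succ, Nat.factorial]

/-- **Design property**: the Gegenbauer moments of orders `1, 2, 3` of a `(6, 27, 1/4)` code vanish.
[cite: CohnKumar2006, Appendix A] -/
theorem moments_of_card_eq_27 {k : ℕ} (hk1 : 1 ≤ k) (hk2 : k ≤ 3) :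
    ∑ x ∈ C, ∑ y ∈ C, gegenbauerSum (2 : ℝ) k (inner ℝ x y) = 0 := by
  classical
  have hinner : ∀ a b : EuclideanSpace ℝ (Fin 6), inner ℝ a b = ∑ j, a j * b j := fun a b => by
    simp [PiLp.inner_apply, mul_comm]
  have key := DelsarteLP.sum_sum_gegenbauerSum_eq_zero_of_card_mul_eq_coord (n := 6) (μ := 2)
    (by norm_num) (by norm_num) 3
    (fun k => match k with | 0 => 1 / 16 | 1 => 3 / 32 | 2 => 1 / 16 | 3 => 1 / 32 | _ => 0)
    ?_ (1 / 4) ?_ (ι := C) (fun a j => (a : EuclideanSpace ℝ (Fin 6)) j) ?_ ?_ ?_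
    (k := k) (Finset.mem_range.2 (by omega)) hk1 ?_
  · have hco : ∑ x ∈ C, ∑ y ∈ C, gegenbauerSum (2 : ℝ) k (inner ℝ x y) =
        ∑ a : C, ∑ b : C, gegenbauerSum (2 : ℝ) k
          (∑ j, (a : EuclideanSpace ℝ (Fin 6)) j * (b : EuclideanSpace ℝ (Fin 6)) j) := by
      rw [← Finset.sum_coe_sort C]
      refine Finset.sum_congr rfl fun a _ => ?_
      rw [← Finset.sum_coe_sort C]
      exact Finset.sum_congr rfl fun b _ => by rw [hinner]
    rw [hco]
    exact key
  · intro k; split <;> norm_num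
  · intro t ht1 ht2
    rw [hpoly]
    exact mul_nonpos_of_nonneg_of_nonpos (by positivity) (by linarith)
  · intro a
    rw [← EuclideanSpace.real_norm_sq_eq, h1 a a.2, one_pow]
  · intro a b hab
    have hne : (a : EuclideanSpace ℝ (Fin 6)) ≠ b := fun h => hab (Subtype.ext h)
    have h := h2 a a.2 b b.2 hne
    rwa [hinner] at h
  · rw [Fintype.card_coe, hN]
    norm_num [Finset.sum_range_succ, gegenbauerSum, gegenbauerCoeff, Finset.prod_range_succ, Nat.factorial]
  · interval_cases k <;> norm_num

/-- Strength `1`: `Σ_{w ∈ C} ⟪u, w⟫ = 0` for every `u`. -/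
theorem sum_inner_eq_zero (u : EuclideanSpace ℝ (Fin 6)) : ∑ w ∈ C, inner ℝ u w = 0 :=
  DesignIdentities.sum_inner_eq_zero (μ := 2) (by norm_num) C
    (moments_of_card_eq_27 h1 h2 hN le_rfl (by norm_num)) u

/-- Strength `2`: `Σ_{w ∈ C} ⟪u, w⟫ ⟪v, w⟫ = (9/2) ⟪u, v⟫` for all `u, v`. -/
theorem sum_inner_mul_inner (u v : EuclideanSpace ℝ (Fin 6)) :
    ∑ w ∈ C, inner ℝ u w * inner ℝ v w = 9 / 2 * inner ℝ u v := by
  have h := DesignIdentities.sum_inner_mul_inner (n := 6) (μ := 2) (by norm_num) (by norm_num) C h1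
    (moments_of_card_eq_27 h1 h2 hN (by norm_num) (by norm_num)) u v
  rw [h, hN]
  norm_num

/-! ### The frame -/

/-- Every point has a point at inner product `1/4`. -/
theorem exists_inner_eq_quarter {x : EuclideanSpace ℝ (Fin 6)} (hx : x ∈ C) :
    ∃ y ∈ C, inner ℝ x y = 1 / 4 := by
  by_contra hcon
  push Not at hcon
  have hval : ∀ w ∈ C.erase x, inner ℝ x w = -1 / 2 := by
    intro w hw
    obtain ⟨hne, hwC⟩ := mem_erase.mp hw
    exact (inner_of_card_eq_27 h1 h2 hN hx hwC (Ne.symm hne)).resolve_left (hcon w hwC)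
  have hs := sum_inner_eq_zero h1 h2 hN x
  rw [← Finset.add_sum_erase C _ hx, real_inner_self_eq_norm_sq, h1 x hx, Finset.sum_congr rfl hval,
    sum_const, card_erase_of_mem hx, hN] at hs
  norm_num at hs

/-- For `⟪x, y⟫ = 1/4`: exactly five points are at `1/4` from `x` and `-1/2` from `y`. -/
theorem card_filter_eq_five {x y : EuclideanSpace ℝ (Fin 6)} (hx : x ∈ C) (hy : y ∈ C)
    (hxy : inner ℝ x y = 1 / 4) :
    (C.filter fun w => inner ℝ x w = 1 / 4 ∧ inner ℝ y w = -1 / 2).card = 5 := by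
  classical
  have hyx : inner ℝ y x = 1 / 4 := by rw [real_inner_comm]; exact hxy
  have hxy' : x ≠ y := by
    intro h; rw [h, real_inner_self_eq_norm_sq, h1 y hy] at hxy; norm_num at hxy
  set P : EuclideanSpace ℝ (Fin 6) → Prop := fun w => inner ℝ x w = 1 / 4 ∧ inner ℝ y w = -1 / 2 with hP
  set F : EuclideanSpace ℝ (Fin 6) → ℝ := fun w => 16 / 9 * ((inner ℝ x w + 1 / 2) * (1 / 4 - inner ℝ y w))
    with hF
  have htot : ∑ w ∈ C, F w = 4 := by
    have hexp : ∀ w, F w = 16 / 9 * (1 / 4 * inner ℝ x w - inner ℝ x w * inner ℝ y w + 1 / 8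
        - 1 / 2 * inner ℝ y w) := fun w => by rw [hF]; ring
    rw [Finset.sum_congr rfl fun w _ => hexp w, ← Finset.mul_sum, Finset.sum_sub_distrib, Finset.sum_add_distrib,
      Finset.sum_sub_distrib, ← Finset.mul_sum, ← Finset.mul_sum, sum_inner_eq_zero h1 h2 hN x,
      sum_inner_eq_zero h1 h2 hN y, sum_inner_mul_inner h1 h2 hN x y, hxy, sum_const, hN]
    norm_num
  have hsplit := Finset.sum_filter_add_sum_filter_not C P F
  have hK : ∑ w ∈ C.filter P, F w = ((C.filter P).card : ℝ) := by
    rw [Finset.sum_congr rfl (fun w hw => ?_), sum_const, nsmul_eq_mul, mul_one]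
    obtain ⟨_, hw1, hw2⟩ := mem_filter.mp hw
    rw [hF]
    simp only [hw1, hw2]
    norm_num
  have hrest : ∑ w ∈ C.filter (fun w => ¬ P w), F w = -1 := by
    have hval : ∀ w ∈ C.filter (fun w => ¬ P w), F w = if w = y then -1 else 0 := by
      intro w hw
      obtain ⟨hwC, hnp⟩ := mem_filter.mp hw
      by_cases hwy : w = y
      · rw [if_pos hwy, hwy, hF]
        simp only [real_inner_self_eq_norm_sq, h1 y hy, hxy]
        norm_num
      · rw [if_neg hwy, hF]
        by_cases hwx : w = x
        · rw [hwx]; simp only [hyx]; norm_num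
        · rcases inner_of_card_eq_27 h1 h2 hN hx hwC (Ne.symm hwx) with hxw | hxw
          · rcases inner_of_card_eq_27 h1 h2 hN hy hwC (Ne.symm hwy) with hyw | hyw
            · simp only [hyw]; norm_num
            · exact absurd ⟨hxw, hyw⟩ hnp
          · simp only [hxw]; norm_num
    have hym : y ∈ C.filter (fun w => ¬ P w) := by
      refine mem_filter.mpr ⟨hy, fun ⟨_, h⟩ => ?_⟩
      rw [real_inner_self_eq_norm_sq, h1 y hy] at h
      norm_num at h
    rw [Finset.sum_congr rfl hval, Finset.sum_ite_eq' _ y, if_pos hym]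
  rw [hK, hrest] at hsplit
  have h5 : ((C.filter P).card : ℝ) = ((5 : ℕ) : ℝ) := by push_cast; linarith
  exact Nat.cast_injective h5

/-- Two distinct points at `1/4` from `x` and `-1/2` from `y` (`⟪x,y⟫ = 1/4`) are at `1/4` from each other. -/
theorem inner_eq_quarter_of_mem {x y w w' : EuclideanSpace ℝ (Fin 6)} (hy : y ∈ C)
    (hxy : inner ℝ x y = 1 / 4) (hw : w ∈ C) (hw' : w' ∈ C) (hxw : inner ℝ x w = 1 / 4)
    (hyw : inner ℝ y w = -1 / 2) (hxw' : inner ℝ x w' = 1 / 4) (hyw' : inner ℝ y w' = -1 / 2) (hne : w ≠ w') :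
    inner ℝ w w' = 1 / 4 := by
  rcases inner_of_card_eq_27 h1 h2 hN hw hw' hne with h | h
  · exact h
  · exfalso
    -- `y, w, w'` pairwise at `-1/2` sum to zero
    have h0 : ‖y + w + w'‖ ^ 2 = 0 := by
      rw [← real_inner_self_eq_norm_sq]
      simp only [inner_add_left, inner_add_right, real_inner_self_eq_norm_sq, h1 y hy, h1 w hw, h1 w' hw']
      linarith [real_inner_comm y w, real_inner_comm y w', real_inner_comm w w']
    have hzero : y + w + w' = 0 := norm_eq_zero.mp (pow_eq_zero_iff two_ne_zero |>.mp h0)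
    have := congrArg (fun v => inner ℝ x v) hzero
    simp only [inner_add_right, inner_zero_right, hxy, hxw, hxw'] at this
    norm_num at this

/-- **The frame.** A `(6, 27, 1/4)` code contains six points pairwise at inner product `1/4`. -/
theorem exists_frame : ∃ a : Fin 6 → EuclideanSpace ℝ (Fin 6), (∀ i, a i ∈ C) ∧
    ∀ i j, inner ℝ (a i) (a j) = if i = j then 1 else 1 / 4 := by
  classical
  have hne : C.Nonempty := by rw [← Finset.card_pos, hN]; norm_num
  obtain ⟨x, hx⟩ := hne
  obtain ⟨y, hy, hxy⟩ := exists_inner_eq_quarter h1 h2 hN hx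
  set K := C.filter fun w => inner ℝ x w = 1 / 4 ∧ inner ℝ y w = -1 / 2 with hK
  have hxK : x ∉ K := by
    intro h
    have := (mem_filter.mp h).2.1
    rw [real_inner_self_eq_norm_sq, h1 x hx] at this
    norm_num at this
  set K' := insert x K with hK'
  have hcard : Fintype.card K' = 6 := by
    rw [Fintype.card_coe, hK', card_insert_of_notMem hxK, card_filter_eq_five h1 h2 hN hx hy hxy]
  have hmemC : ∀ w ∈ K', w ∈ C := by
    intro w hw
    rcases mem_insert.mp hw with rfl | hw
    · exact hx
    · exact (mem_filter.mp hw).1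
  have hpair : ∀ w ∈ K', ∀ w' ∈ K', w ≠ w' → inner ℝ w w' = 1 / 4 := by
    intro w hw w' hw' hne
    rcases mem_insert.mp hw with rfl | hwK
    · rcases mem_insert.mp hw' with rfl | hw'K
      · exact absurd rfl hne
      · exact (mem_filter.mp hw'K).2.1
    · rcases mem_insert.mp hw' with rfl | hw'K
      · rw [real_inner_comm]; exact (mem_filter.mp hwK).2.1
      · obtain ⟨hwC, hxw, hyw⟩ := mem_filter.mp hwK
        obtain ⟨hw'C, hxw', hyw'⟩ := mem_filter.mp hw'K
        exact inner_eq_quarter_of_mem h1 h2 hN hy hxy hwC hw'C hxw hyw hxw' hyw' hne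
  let e : K' ≃ Fin 6 := Fintype.equivFinOfCardEq hcard
  refine ⟨fun i => ((e.symm i : K') : EuclideanSpace ℝ (Fin 6)), fun i => hmemC _ (e.symm i).2, ?_⟩
  intro i j
  by_cases hij : i = j
  · subst hij
    rw [if_pos rfl, real_inner_self_eq_norm_sq, h1 _ (hmemC _ (e.symm i).2), one_pow]
  · rw [if_neg hij]
    have hne : ((e.symm i : K') : EuclideanSpace ℝ (Fin 6)) ≠ (e.symm j : K') := by
      intro h
      exact hij (e.symm.injective (Subtype.ext h))
    exact hpair _ (e.symm i).2 _ (e.symm j).2 hne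

end config

/-! ### Index data of the family and the profile of a point -/

/-- Index set of the `27`-point family: frame vectors (`{k}`, coefficient `0`), the six points `a_k - σ/3`
(`{k}`, `1/3`), and the fifteen points `Σ_{j ∈ T} aⱼ - (2/3)σ`, `|T| = 4` (`σ = Σ aⱼ`). -/
abbrev Idx : Type := Fin 6 ⊕ Fin 6 ⊕ {T : Finset (Fin 6) // T.card = 4}

/-- The subset of the frame entering the member of the family. -/
def setOf : Idx → Finset (Fin 6)
  | Sum.inl k => {k}
  | Sum.inr (Sum.inl k) => {k}
  | Sum.inr (Sum.inr T) => T.1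

/-- The coefficient of `σ = Σ aⱼ` subtracted in the member of the family. -/
def coefOf : Idx → ℝ
  | Sum.inl _ => 0
  | Sum.inr (Sum.inl _) => 1 / 3
  | Sum.inr (Sum.inr _) => 2 / 3

/-- The index set has `27 = 6 + 6 + 15` elements. -/
theorem card_Idx : Fintype.card Idx = 27 := by
  simp only [Idx, Fintype.card_sum, Fintype.card_fin]
  rfl

/-- `fam a T c` as a single sum of multiples of the frame. -/
private theorem fam_eq_sum {a : Fin 6 → EuclideanSpace ℝ (Fin 6)} (T : Finset (Fin 6)) (c : ℝ) :
    fam a T c = ∑ j, ((if j ∈ T then (1 : ℝ) else 0) - c) • a j := by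
  classical
  simp only [fam, sub_smul, Finset.sum_sub_distrib, ite_smul, one_smul, zero_smul, Finset.sum_ite_mem,
    Finset.univ_inter, Finset.smul_sum]

section profile

variable {C : Finset (EuclideanSpace ℝ (Fin 6))} (h1 : ∀ x ∈ C, ‖x‖ = 1)
  (h2 : ∀ x ∈ C, ∀ y ∈ C, x ≠ y → inner ℝ x y ≤ 1 / 4) (hN : C.card = 27)
  {a : Fin 6 → EuclideanSpace ℝ (Fin 6)} (ha : ∀ i, a i ∈ C)
  (hG : ∀ i j, inner ℝ (a i) (a j) = if i = j then 1 else 1 / 4)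
include h1 h2 hN ha hG

/-- **Every point of the code is a member of the fixed family over the frame.** -/
theorem exists_index {z : EuclideanSpace ℝ (Fin 6)} (hz : z ∈ C) :
    ∃ x : Idx, z = fam a (setOf x) (coefOf x) := by
  classical
  by_cases hza : ∃ k, z = a k
  · obtain ⟨k, rfl⟩ := hza
    exact ⟨Sum.inl k, (fam_singleton_zero a k).symm⟩
  push Not at hza
  have hb : ∀ k, inner ℝ z (a k) = 1 / 4 ∨ inner ℝ z (a k) = -1 / 2 := fun k =>
    inner_of_card_eq_27 h1 h2 hN hz (ha k) (hza k)
  have hcard : Fintype.card (Fin 6) = finrank ℝ (EuclideanSpace ℝ (Fin 6)) := by simp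
  have hrepr := repr_formula hG (by norm_num) (by norm_num) hcard z
  have hnorm := norm_identity hG (by norm_num) (by norm_num) hcard z
  have hs1 := sum_comp_two_values (fun k => inner ℝ z (a k)) hb (fun t => t)
  have hs2 := sum_comp_two_values (fun k => inner ℝ z (a k)) hb (fun t => t ^ 2)
  set S := univ.filter fun k => inner ℝ z (a k) = -1 / 2 with hS
  simp only [Fintype.card_fin, Nat.cast_ofNat] at hrepr hnorm hs1 hs2
  rw [h1 z hz, hs1, hs2] at hnorm
  have hs : S.card = 2 ∨ S.card = 5 := by
    have hq : ((S.card : ℝ) - 2) * ((S.card : ℝ) - 5) = 0 := by nlinarith [hnorm]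
    rcases mul_eq_zero.mp hq with h | h
    · left; exact_mod_cast (by linarith : (S.card : ℝ) = 2)
    · right; exact_mod_cast (by linarith : (S.card : ℝ) = 5)
  have hcoef : ∀ j, (inner ℝ z (a j) - 1 / 4 * (∑ i, inner ℝ z (a i)) / (1 + (6 - 1) * (1 / 4))) / (1 - 1 / 4)
      = (if j ∈ univ \ S then (1 : ℝ) else 0) - (8 - (S.card : ℝ)) / 9 := by
    intro j
    rw [hs1]
    by_cases hj : inner ℝ z (a j) = -1 / 2
    · have hjS : j ∈ S := mem_filter.mpr ⟨mem_univ j, hj⟩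
      rw [if_neg (fun h => (mem_sdiff.mp h).2 hjS), hj]
      ring
    · have hjS : j ∉ S := fun h => hj (mem_filter.mp h).2
      rw [if_pos (mem_sdiff.mpr ⟨mem_univ j, hjS⟩), (hb j).resolve_right hj]
      ring
  have hz' : z = fam a (univ \ S) ((8 - (S.card : ℝ)) / 9) := by
    rw [fam_eq_sum]
    conv_lhs => rw [hrepr]
    exact Finset.sum_congr rfl fun j _ => by rw [hcoef j]
  rcases hs with hs | hs
  · -- fifteen points: `T = Sᶜ`, `|T| = 4`, coefficient `2/3`
    have hT : (univ \ S).card = 4 := by rw [Finset.card_univ_sdiff, Fintype.card_fin, hs]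
    refine ⟨Sum.inr (Sum.inr ⟨univ \ S, hT⟩), ?_⟩
    rw [hz', setOf, coefOf, hs]
    norm_num
  · -- six points `a_k - σ/3`: `T = Sᶜ = {k}`, coefficient `1/3`
    have hT : (univ \ S).card = 1 := by rw [Finset.card_univ_sdiff, Fintype.card_fin, hs]
    obtain ⟨k, hk⟩ := Finset.card_eq_one.mp hT
    refine ⟨Sum.inr (Sum.inl k), ?_⟩
    rw [hz', setOf, coefOf, hs, hk]
    norm_num

/-- **The code is the image of the fixed family over the frame.** -/
theorem eq_image : C = univ.image fun x : Idx => fam a (setOf x) (coefOf x) := by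
  classical
  exact eq_image_of_forall_exists C _ (fun z hz => exists_index h1 h2 hN ha hG hz) (by rw [card_Idx, hN])

end profile

/-! ### Uniqueness -/

/-- **Uniqueness of the `(6, 27, 1/4)` code.** Any two `27`-point codes in `ℝ⁶` with pairwise inner products
`≤ 1/4` are isometric. [cite: CohnKumar2006, Appendix A] -/
theorem isometric {C C' : Finset (EuclideanSpace ℝ (Fin 6))} (h1 : ∀ x ∈ C, ‖x‖ = 1)
    (h2 : ∀ x ∈ C, ∀ y ∈ C, x ≠ y → inner ℝ x y ≤ 1 / 4) (hN : C.card = 27) (h1' : ∀ x ∈ C', ‖x‖ = 1)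
    (h2' : ∀ x ∈ C', ∀ y ∈ C', x ≠ y → inner ℝ x y ≤ 1 / 4) (hN' : C'.card = 27) :
    ∃ Ψ : EuclideanSpace ℝ (Fin 6) ≃ₗᵢ[ℝ] EuclideanSpace ℝ (Fin 6), C' = C.image Ψ := by
  classical
  obtain ⟨a, ha, hG⟩ := exists_frame h1 h2 hN
  obtain ⟨a', ha', hG'⟩ := exists_frame h1' h2' hN'
  exact isometric_of_frames setOf coefOf hG hG' (eq_image h1 h2 hN ha hG) (eq_image h1' h2' hN' ha' hG')

/-- **Ground-state form**: a `27`-point configuration on `S⁵` attaining the universal lower bound of the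
`(1+t)^k`-energy for one `k ≥ 4` is isometric to every `(6, 27, 1/4)` code — the `E₆` configuration is the unique
ground state (Cohn–Kumar Thm 1.2, uniqueness for the row `(6, 27)`). [cite: CohnKumar2006, Theorem 1.2 and Appendix A] -/
theorem isometric_of_ckPow_energy_eq {C C' : Finset (EuclideanSpace ℝ (Fin 6))} (h1 : ∀ x ∈ C, ‖x‖ = 1)
    (hN : C.card = 27) (k : ℕ) (hk : 4 ≤ k)
    (hE : ∑ x ∈ C, ∑ y ∈ C.erase x, (1 + inner ℝ x y) ^ k =
      (27 : ℝ) * (10 * (1 + (-1 / 2 : ℝ)) ^ k + 16 * (1 + (1 / 4 : ℝ)) ^ k))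
    (h1' : ∀ x ∈ C', ‖x‖ = 1) (h2' : ∀ x ∈ C', ∀ y ∈ C', x ≠ y → inner ℝ x y ≤ 1 / 4) (hN' : C'.card = 27) :
    ∃ Ψ : EuclideanSpace ℝ (Fin 6) ≃ₗᵢ[ℝ] EuclideanSpace ℝ (Fin 6), C = C'.image Ψ :=
  isometric h1' h2' hN' h1 (Dim6Card27EnergyRigidity.inner_le_of_ckPow_energy_eq h1 hN k hk hE) hN

end Summit.Ventures.PackingBounds.Config.Dim6Card27Unique

end
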